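import Literature.Probability.Process.RootedHardCoreVague
import Literature.MathematicalPhysics.StatisticalMechanics.RootEnergy
import Mathlib.Topology.UniformSpace.UniformApproximation

/-!
# Benjamini–Schramm limit of ground states, IV: the root energy is a continuous local functional

Route `PalmUnimodularRigidity`, item `stmt-AtomisticToContinuum-9230` (`BenjaminiSchrammLimit`),
helper file 4. On the compact metric space of rooted `δ`-hard-core configurations of `ℝ³`
(`RootedHardCoreConfig`, Literature `Probability/Process`), the Lennard-Jones interaction of the
root with the configuration, `S ↦ ∫ V_LJ(‖y‖) d(count|S) = ∑_{y ∈ S} V_LJ(‖y‖)`, is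

* an honest absolutely convergent sum (`integrable_lennardJones_toMeasure`): the shell sum
  `∑_{y ∈ T} ‖y‖⁻⁵ ≤ 250 δ⁻⁵` over points `δ`-separated from each other and from the root
  (`Finset.sum_norm_inv_pow_five_le`, the packing argument of `sum_inv_pow_six_le` in
  `LennardJonesClusters.lean` one power lower), and `|V_LJ(r)| ≤ c_δ r⁻⁵` for `r ≥ δ`;
* approximated UNIFORMLY in `S` by the continuous local functionals `S ↦ ∑_{y ∈ S} ρ_R(‖y‖) V_LJ(‖y‖)`
  (`ρ_R` a continuous cut-off, `LocalConfig.continuous_integral_toMeasure`) with error the tail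
  `∑_{‖y‖ > R} |V_LJ(‖y‖)| ≤ (125/2) δ⁻⁵ / R` (`abs_integral_lennardJones_sub_cutoff_le`);
* hence CONTINUOUS (`continuous_integral_lennardJones_toMeasure`), so that the mean root energy
  passes to weak (Benjamini–Schramm) limits of laws of rooted configurations.
-/

noncomputable section

open MeasureTheory Set Filter Metric TopologicalSpace
open scoped Topology ENNReal NNReal BigOperators

namespace Summit.AtomisticToContinuum.Crystallization.Theorems.BenjaminiSchrammLimit

open Literature.Probability.Process Literature.Probability.Process.LocalConfig
open Literature.MathematicalPhysics.StatisticalMechanics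

/-- `ℝ³`. -/
local notation "E3" => EuclideanSpace ℝ (Fin 3)

/-! ### The shell sum one power lower -/
/-- **Shell sum.** If the points of a finite set `T ⊆ ℝ³` are at mutual distances `≥ r > 0` and at
distance `≥ r` from the origin, then `∑_{y ∈ T} ‖y‖⁻⁵ ≤ 250 · r⁻⁵`: the shell `⌊‖y‖ / r⌋ = b`
(`b ≥ 1`) contains at most `(2b + 3)³ ≤ 125 b³` points (packing bound
`card_le_of_separated_of_dist_le`), each contributing `≤ (b r)⁻⁵`, and `∑_{b ≥ 1} b⁻² ≤ 2`.
(The argument of `sum_inv_pow_six_le`, one power lower.) [folklore] -/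
theorem Finset.sum_norm_inv_pow_five_le (T : Finset E3) {r : ℝ} (hr : 0 < r)
    (hsep : ∀ y ∈ T, ∀ y' ∈ T, y ≠ y' → r ≤ dist y y') (h0 : ∀ y ∈ T, r ≤ ‖y‖) :
    ∑ y ∈ T, ‖y‖⁻¹ ^ 5 ≤ 250 * r⁻¹ ^ 5 := by
  set m : E3 → ℕ := fun y => ⌊‖y‖ / r⌋₊ with hm
  set t := T.image m with ht_def
  have hmem : ∀ y ∈ T, m y ∈ t := fun y hy => Finset.mem_image_of_mem m hy
  have hm1 : ∀ y ∈ T, 1 ≤ m y := fun y hy =>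
    (Nat.one_le_floor_iff _).2 ((one_le_div hr).2 (h0 y hy))
  have hmle : ∀ y ∈ T, r * m y ≤ ‖y‖ := fun y hy => by
    have := Nat.floor_le (div_nonneg (norm_nonneg y) hr.le : 0 ≤ ‖y‖ / r)
    rwa [le_div_iff₀ hr, mul_comm] at this
  have hmlt : ∀ y ∈ T, ‖y‖ < (m y + 1) * r := fun y hy => by
    have := Nat.lt_floor_add_one (‖y‖ / r)
    rwa [div_lt_iff₀ hr] at this
  -- termwise: `‖y‖⁻⁵ ≤ (r m_y)⁻⁵`
  have step1 : ∑ y ∈ T, ‖y‖⁻¹ ^ 5 ≤ ∑ y ∈ T, r⁻¹ ^ 5 * ((m y : ℝ))⁻¹ ^ 5 := by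
    refine Finset.sum_le_sum fun y hy => ?_
    rw [← mul_pow, ← mul_inv]
    have h0' : 0 < r * m y := mul_pos hr (by exact_mod_cast hm1 y hy)
    exact pow_le_pow_left₀ (inv_nonneg.2 (norm_nonneg _)) (inv_anti₀ h0' (hmle y hy)) _
  -- regroup by shells
  have step2 : ∑ y ∈ T, r⁻¹ ^ 5 * ((m y : ℝ))⁻¹ ^ 5 =
      ∑ b ∈ t, ((T.filter fun y => m y = b).card : ℝ) * (r⁻¹ ^ 5 * ((b : ℝ))⁻¹ ^ 5) := by
    have := Finset.sum_fiberwise_of_maps_to' hmem (fun b : ℕ => r⁻¹ ^ 5 * ((b : ℝ))⁻¹ ^ 5)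
    simp only [Finset.sum_const, nsmul_eq_mul] at this
    exact this.symm
  -- each shell holds at most `(2b+3)³` points
  have step3 : ∀ b ∈ t, ((T.filter fun y => m y = b).card : ℝ) ≤ (2 * (b : ℝ) + 3) ^ 3 := by
    intro b _
    set F := T.filter fun y => m y = b with hF
    have hR : (0 : ℝ) ≤ ((b : ℝ) + 1) * r := by positivity
    have := card_le_of_separated_of_dist_le F (0 : E3) hr hR ?_ ?_
    · rw [finrank_euclideanSpace_fin] at this
      convert this using 2
      field_simp
      ring
    · intro c hc
      obtain ⟨hcT, hcb⟩ := Finset.mem_filter.1 hc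
      rw [dist_zero_right]
      have := hmlt c hcT
      rw [hcb] at this
      exact this.le
    · intro c hc c' hc' hne
      exact hsep c (Finset.mem_filter.1 hc).1 c' (Finset.mem_filter.1 hc').1 hne
  -- numerics per shell: `(2b+3)³ b⁻⁵ ≤ 125 b⁻²` for `b ≥ 1`
  have step4 : ∀ b ∈ t, (2 * (b : ℝ) + 3) ^ 3 * (r⁻¹ ^ 5 * ((b : ℝ))⁻¹ ^ 5) ≤
      125 * r⁻¹ ^ 5 * ((b : ℝ) ^ 2)⁻¹ := by
    intro b hb
    obtain ⟨y, hy, rfl⟩ := Finset.mem_image.1 hb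
    have hb1 : (1 : ℝ) ≤ (m y : ℝ) := by exact_mod_cast hm1 y hy
    set β : ℝ := (m y : ℝ)
    have hβ : 0 < β := by linarith
    have hr5 : 0 < r⁻¹ ^ 5 := by positivity
    have key : (2 * β + 3) ^ 3 * (β⁻¹) ^ 5 ≤ 125 * (β ^ 2)⁻¹ := by
      rw [inv_pow, ← div_eq_mul_inv, ← div_eq_mul_inv,
        div_le_div_iff₀ (by positivity) (by positivity)]
      have h5 : (2 * β + 3) ^ 3 ≤ (5 * β) ^ 3 :=
        pow_le_pow_left₀ (by positivity) (by linarith) 3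
      have h6 : β ^ 4 ≤ β ^ 5 := pow_le_pow_right₀ hb1 (by norm_num)
      nlinarith [mul_le_mul_of_nonneg_right h5 (sq_nonneg β)]
    calc (2 * β + 3) ^ 3 * (r⁻¹ ^ 5 * (β⁻¹) ^ 5) = r⁻¹ ^ 5 * ((2 * β + 3) ^ 3 * (β⁻¹) ^ 5) := by
          ring
      _ ≤ r⁻¹ ^ 5 * (125 * (β ^ 2)⁻¹) := mul_le_mul_of_nonneg_left key hr5.le
      _ = 125 * r⁻¹ ^ 5 * (β ^ 2)⁻¹ := by ring
  -- `∑_{b ∈ t} b⁻² ≤ 2`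
  have step5 : ∑ b ∈ t, ((b : ℝ) ^ 2)⁻¹ ≤ 2 := by
    have hsub : t ⊆ Finset.Ioo 0 (t.sup id + 1) := fun b hb => by
      rw [Finset.mem_Ioo]
      obtain ⟨y, hy, rfl⟩ := Finset.mem_image.1 hb
      exact ⟨hm1 y hy, Nat.lt_succ_of_le (Finset.le_sup (f := id) hb)⟩
    have h2 := sum_Ioo_inv_sq_le (α := ℝ) 0 (t.sup id + 1)
    calc ∑ b ∈ t, ((b : ℝ) ^ 2)⁻¹ ≤ ∑ b ∈ Finset.Ioo 0 (t.sup id + 1), ((b : ℝ) ^ 2)⁻¹ :=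
          Finset.sum_le_sum_of_subset_of_nonneg hsub fun b _ _ => by positivity
      _ ≤ 2 := by simpa using h2
  calc ∑ y ∈ T, ‖y‖⁻¹ ^ 5
      ≤ ∑ b ∈ t, ((T.filter fun y => m y = b).card : ℝ) * (r⁻¹ ^ 5 * ((b : ℝ))⁻¹ ^ 5) :=
        step1.trans_eq step2
    _ ≤ ∑ b ∈ t, (2 * (b : ℝ) + 3) ^ 3 * (r⁻¹ ^ 5 * ((b : ℝ))⁻¹ ^ 5) :=
        Finset.sum_le_sum fun b hb => mul_le_mul_of_nonneg_right (step3 b hb) (by positivity)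
    _ ≤ ∑ b ∈ t, 125 * r⁻¹ ^ 5 * ((b : ℝ) ^ 2)⁻¹ := Finset.sum_le_sum step4
    _ = 125 * r⁻¹ ^ 5 * ∑ b ∈ t, ((b : ℝ) ^ 2)⁻¹ := by rw [Finset.mul_sum]
    _ ≤ 125 * r⁻¹ ^ 5 * 2 := mul_le_mul_of_nonneg_left step5 (by positivity)
    _ = 250 * r⁻¹ ^ 5 := by ring

/-! ### Pointwise bounds on the Lennard-Jones potential -/
/-- `|V_LJ(s)| ≤ ((1/12) δ⁻⁷ + (1/6) δ⁻¹) s⁻⁵` for `s ≥ δ > 0`. [folklore] -/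
theorem abs_lennardJones_le {δ s : ℝ} (hδ : 0 < δ) (hs : δ ≤ s) :
    |lennardJones s| ≤ ((1 / 12) * δ⁻¹ ^ 7 + (1 / 6) * δ⁻¹) * s⁻¹ ^ 5 := by
  have hs0 : 0 < s := hδ.trans_le hs
  have hi : 0 ≤ s⁻¹ := inv_nonneg.2 hs0.le
  have hsi : s⁻¹ ≤ δ⁻¹ := inv_anti₀ hδ hs
  have h12 : (s⁻¹) ^ 12 ≤ δ⁻¹ ^ 7 * s⁻¹ ^ 5 := by
    rw [show (s⁻¹) ^ 12 = (s⁻¹) ^ 7 * (s⁻¹) ^ 5 by ring]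
    exact mul_le_mul_of_nonneg_right (pow_le_pow_left₀ hi hsi 7) (by positivity)
  have h6 : (s⁻¹) ^ 6 ≤ δ⁻¹ * s⁻¹ ^ 5 := by
    rw [show (s⁻¹) ^ 6 = s⁻¹ * (s⁻¹) ^ 5 by ring]
    exact mul_le_mul_of_nonneg_right hsi (by positivity)
  unfold lennardJones
  rw [abs_le]
  constructor
  · nlinarith [pow_nonneg hi 12, pow_nonneg hi 6]
  · nlinarith [pow_nonneg hi 12, pow_nonneg hi 6]

/-- Tail bound: `|V_LJ(s)| ≤ (1/4) R⁻¹ s⁻⁵` for `s ≥ R ≥ 1`. [folklore] -/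
theorem abs_lennardJones_le_tail {R s : ℝ} (hR : 1 ≤ R) (hs : R ≤ s) :
    |lennardJones s| ≤ (1 / 4) * R⁻¹ * s⁻¹ ^ 5 := by
  have hs0 : 0 < s := by linarith
  have hi : 0 ≤ s⁻¹ := inv_nonneg.2 hs0.le
  have hs1 : s⁻¹ ≤ 1 := inv_le_one_of_one_le₀ (hR.trans hs)
  have hsR : s⁻¹ ≤ R⁻¹ := inv_anti₀ (by linarith) hs
  have h6 : (s⁻¹) ^ 6 ≤ R⁻¹ * s⁻¹ ^ 5 := by
    rw [show (s⁻¹) ^ 6 = s⁻¹ * (s⁻¹) ^ 5 by ring]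
    exact mul_le_mul_of_nonneg_right hsR (by positivity)
  have h12 : (s⁻¹) ^ 12 ≤ (s⁻¹) ^ 6 := pow_le_pow_of_le_one hi hs1 (by norm_num)
  unfold lennardJones
  rw [abs_le]
  constructor
  · nlinarith [pow_nonneg hi 12, pow_nonneg hi 6]
  · nlinarith [pow_nonneg hi 12, pow_nonneg hi 6]

/-! ### Finite partial sums over rooted hard-core configurations -/
variable {δ : ℝ}

/-- A finite set of points of a rooted `δ`-hard-core configuration, without the root, consists of
points at mutual distances `≥ δ` and at distance `≥ δ` from the root. [folklore] -/
theorem norm_ge_of_mem (S : RootedHardCoreConfig E3 δ) {y : E3}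
    (hy : y ∈ ((S.1 : LocalConfig E3) : Set E3)) (hy0 : y ≠ 0) : δ ≤ ‖y‖ := by
  have := S.2.2 y hy 0 S.2.1 hy0
  rwa [dist_zero_right] at this

/-- **Absolute convergence, finite form**: `∑_{y ∈ T} |V_LJ(‖y‖)| ≤ 250 ((1/12) δ⁻⁷ + (1/6) δ⁻¹) δ⁻⁵`
for every finite set `T` of points of a rooted `δ`-hard-core configuration (`δ > 0`; the root
contributes `V_LJ(0) = 0`). [folklore] -/
theorem sum_abs_lennardJones_le (hδ : 0 < δ) (S : RootedHardCoreConfig E3 δ) (T : Finset E3)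
    (hT : (↑T : Set E3) ⊆ ((S.1 : LocalConfig E3) : Set E3)) :
    ∑ y ∈ T, |lennardJones ‖y‖| ≤ 250 * (((1 / 12) * δ⁻¹ ^ 7 + (1 / 6) * δ⁻¹) * δ⁻¹ ^ 5) := by
  classical
  have h0 : ∑ y ∈ T, |lennardJones ‖y‖| = ∑ y ∈ T.erase 0, |lennardJones ‖y‖| := by
    by_cases h : (0 : E3) ∈ T
    · rw [← Finset.add_sum_erase T _ h, norm_zero, lennardJones_zero, abs_zero, zero_add]
    · rw [Finset.erase_eq_of_notMem h]
  rw [h0]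
  have hT' : ∀ y ∈ T.erase 0, y ∈ ((S.1 : LocalConfig E3) : Set E3) ∧ y ≠ 0 := fun y hy =>
    ⟨hT (Finset.mem_of_mem_erase hy), Finset.ne_of_mem_erase hy⟩
  calc ∑ y ∈ T.erase 0, |lennardJones ‖y‖|
      ≤ ∑ y ∈ T.erase 0, ((1 / 12) * δ⁻¹ ^ 7 + (1 / 6) * δ⁻¹) * ‖y‖⁻¹ ^ 5 :=
        Finset.sum_le_sum fun y hy =>
          abs_lennardJones_le hδ (norm_ge_of_mem S (hT' y hy).1 (hT' y hy).2)
    _ = ((1 / 12) * δ⁻¹ ^ 7 + (1 / 6) * δ⁻¹) * ∑ y ∈ T.erase 0, ‖y‖⁻¹ ^ 5 := by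
        rw [Finset.mul_sum]
    _ ≤ ((1 / 12) * δ⁻¹ ^ 7 + (1 / 6) * δ⁻¹) * (250 * δ⁻¹ ^ 5) := by
        refine mul_le_mul_of_nonneg_left (Finset.sum_norm_inv_pow_five_le _ hδ
          (fun y hy y' hy' hne => S.2.2 y (hT' y hy).1 y' (hT' y' hy').1 hne)
          fun y hy => norm_ge_of_mem S (hT' y hy).1 (hT' y hy).2) (by positivity)
    _ = 250 * (((1 / 12) * δ⁻¹ ^ 7 + (1 / 6) * δ⁻¹) * δ⁻¹ ^ 5) := by ring

/-- **Uniform tail, finite form**: for `R ≥ 1`, `∑_{y ∈ T, ‖y‖ > R} |V_LJ(‖y‖)| ≤ (125/2) δ⁻⁵ R⁻¹`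
for every finite set `T` of points of a rooted `δ`-hard-core configuration (`δ > 0`). [folklore] -/
theorem sum_abs_lennardJones_tail_le (hδ : 0 < δ) (S : RootedHardCoreConfig E3 δ) (T : Finset E3)
    (hT : (↑T : Set E3) ⊆ ((S.1 : LocalConfig E3) : Set E3)) {R : ℝ} (hR : 1 ≤ R)
    (hTR : ∀ y ∈ T, R < ‖y‖) :
    ∑ y ∈ T, |lennardJones ‖y‖| ≤ (125 / 2) * δ⁻¹ ^ 5 * R⁻¹ := by
  have hT0 : ∀ y ∈ T, y ≠ 0 := fun y hy hy0 => by
    have := hTR y hy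
    rw [hy0, norm_zero] at this
    linarith
  calc ∑ y ∈ T, |lennardJones ‖y‖|
      ≤ ∑ y ∈ T, (1 / 4) * R⁻¹ * ‖y‖⁻¹ ^ 5 :=
        Finset.sum_le_sum fun y hy => abs_lennardJones_le_tail hR (hTR y hy).le
    _ = (1 / 4) * R⁻¹ * ∑ y ∈ T, ‖y‖⁻¹ ^ 5 := by rw [Finset.mul_sum]
    _ ≤ (1 / 4) * R⁻¹ * (250 * δ⁻¹ ^ 5) := by
        refine mul_le_mul_of_nonneg_left (Finset.sum_norm_inv_pow_five_le _ hδ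
          (fun y hy y' hy' hne => S.2.2 y (hT hy) y' (hT hy') hne)
          fun y hy => norm_ge_of_mem S (hT hy) (hT0 y hy)) (by positivity)
    _ = (125 / 2) * δ⁻¹ ^ 5 * R⁻¹ := by ring

/-! ### From finite partial sums to integrals against `count|S` -/
/-- A `δ`-separated subset of a proper space (`δ > 0`) is countable. [folklore] -/
theorem countable_coe (hδ : 0 < δ) (S : RootedHardCoreConfig E3 δ) :
    (((S.1 : LocalConfig E3) : Set E3)).Countable := by
  have : ((S.1 : LocalConfig E3) : Set E3) = ⋃ n : ℕ, closedBall (0 : E3) n ∩ (S.1 : LocalConfig E3) := by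
    ext x
    simp only [mem_iUnion, mem_inter_iff, SetLike.mem_coe]
    exact ⟨fun hx => ⟨⌈‖x‖⌉₊, mem_closedBall_zero_iff.2 (Nat.le_ceil _), hx⟩,
      fun ⟨_, _, hx⟩ => hx⟩
  rw [this]
  exact countable_iUnion fun n =>
    (finite_inter_of_separated hδ S.2.2 (isCompact_closedBall _ _)).countable

/-- **Integrals against `count|S` are bounded by bounds on finite partial sums.** [folklore] -/
theorem lintegral_toMeasure_le_of_forall_finset (hδ : 0 < δ) (S : RootedHardCoreConfig E3 δ)
    {g : E3 → ℝ≥0∞} {c : ℝ≥0∞}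
    (h : ∀ T : Finset E3, (↑T : Set E3) ⊆ ((S.1 : LocalConfig E3) : Set E3) → ∑ y ∈ T, g y ≤ c) :
    ∫⁻ y, g y ∂((S.1 : LocalConfig E3).toMeasure) ≤ c := by
  classical
  rw [toMeasure_def, lintegral_countable _ (countable_coe hδ S), ENNReal.tsum_eq_iSup_sum]
  simp only [Measure.count_singleton, mul_one]
  refine iSup_le fun s => ?_
  have := h (s.map (Function.Embedding.subtype _)) (by
    intro y hy
    rw [Finset.coe_map, Function.Embedding.coe_subtype] at hy
    obtain ⟨z, -, rfl⟩ := hy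
    exact z.2)
  rwa [Finset.sum_map] at this

/-- `y ↦ V_LJ(‖y‖)` is measurable. [folklore] -/
theorem measurable_lennardJones_norm : Measurable fun y : E3 => lennardJones ‖y‖ := by
  unfold lennardJones
  fun_prop

/-- **The root energy is an absolutely convergent sum**: `y ↦ V_LJ(‖y‖)` is integrable against
`count|S` for every rooted `δ`-hard-core configuration `S` of `ℝ³` (`δ > 0`). [folklore] -/
theorem integrable_lennardJones_toMeasure (hδ : 0 < δ) (S : RootedHardCoreConfig E3 δ) :
    Integrable (fun y : E3 => lennardJones ‖y‖) ((S.1 : LocalConfig E3).toMeasure) := by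
  refine ⟨measurable_lennardJones_norm.aestronglyMeasurable, ?_⟩
  refine (lintegral_toMeasure_le_of_forall_finset hδ S (g := fun y => ‖lennardJones ‖y‖‖ₑ)
    (c := ENNReal.ofReal (250 * (((1 / 12) * δ⁻¹ ^ 7 + (1 / 6) * δ⁻¹) * δ⁻¹ ^ 5)))
    fun T hT => ?_).trans_lt ENNReal.ofReal_lt_top
  simp_rw [Real.enorm_eq_ofReal_abs]
  rw [← ENNReal.ofReal_sum_of_nonneg fun y _ => abs_nonneg _]
  exact ENNReal.ofReal_le_ofReal (sum_abs_lennardJones_le hδ S T hT)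

/-! ### Continuous cut-offs and the uniform tail -/

set_option quotPrecheck false in
/-- The cut-off `ρ_R(s)`: continuous, `0 ≤ ρ_R ≤ 1`, `ρ_R = 0` on `(-∞, δ/2] ∪ [R+1, ∞)`, `ρ_R = 1`
on `[δ, R]`. -/
local notation "ρ[" R ", " s "]" => max 0 (min (min 1 ((s - δ / 2) * (2 / δ))) (R + 1 - s))

/-- The truncated root potential `y ↦ ρ_R(‖y‖) V_LJ(‖y‖)` is continuous (the cut-off vanishes
near the singularity of `V_LJ` at the root) with compact support. [folklore] -/
theorem continuous_cutoff_mul (hδ : 0 < δ) (R : ℝ) :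
    Continuous (fun y : E3 => ρ[R, ‖y‖] * lennardJones ‖y‖) ∧
      HasCompactSupport fun y : E3 => ρ[R, ‖y‖] * lennardJones ‖y‖ := by
  have hρc : Continuous fun s : ℝ => ρ[R, s] := by fun_prop
  have hψ : Continuous fun s : ℝ => ρ[R, s] * lennardJones s := by
    refine continuous_iff_continuousAt.2 fun s => ?_
    by_cases hs : s < δ / 2
    · have hev : (fun s : ℝ => ρ[R, s] * lennardJones s) =ᶠ[𝓝 s] fun _ => 0 := by
        filter_upwards [Iio_mem_nhds hs] with u hu
        have : (u - δ / 2) * (2 / δ) ≤ 0 :=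
          mul_nonpos_of_nonpos_of_nonneg (by linarith [mem_Iio.1 hu]) (by positivity)
        have : ρ[R, u] = 0 := by
          refine max_eq_left ((min_le_left _ _).trans ((min_le_right _ _).trans this))
        simp [this]
      exact (continuousAt_const.congr hev.symm :)
    · have hs0 : s ≠ 0 := by intro h; rw [h] at hs; exact hs (half_pos hδ)
      exact hρc.continuousAt.mul (continuousOn_lennardJones.continuousAt
        (isOpen_compl_singleton.mem_nhds hs0))
  refine ⟨hψ.comp continuous_norm, ?_⟩
  refine HasCompactSupport.intro (isCompact_closedBall (0 : E3) (R + 1)) fun y hy => ?_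
  rw [mem_closedBall_zero_iff, not_le] at hy
  have : ρ[R, ‖y‖] = 0 :=
    max_eq_left ((min_le_right _ _).trans (by linarith))
  simp [this]

/-- **Uniform tail of the root energy.** For `δ > 0`, `R ≥ 1` and every rooted `δ`-hard-core
configuration `S` of `ℝ³`,
`|∑_{y ∈ S} V_LJ(‖y‖) - ∑_{y ∈ S} ρ_R(‖y‖) V_LJ(‖y‖)| ≤ ∑_{‖y‖ > R} |V_LJ(‖y‖)| ≤ (125/2) δ⁻⁵ / R`
(on `S`, `1 - ρ_R(‖y‖)` vanishes at the root and for `δ ≤ ‖y‖ ≤ R`). [folklore] -/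
theorem abs_integral_lennardJones_sub_cutoff_le (hδ : 0 < δ) (S : RootedHardCoreConfig E3 δ)
    {R : ℝ} (hR : 1 ≤ R) :
    |∫ y, lennardJones ‖y‖ ∂((S.1 : LocalConfig E3).toMeasure) -
        ∫ y, ρ[R, ‖y‖] * lennardJones ‖y‖ ∂((S.1 : LocalConfig E3).toMeasure)| ≤
      (125 / 2) * δ⁻¹ ^ 5 * R⁻¹ := by
  classical
  set μ : Measure E3 := (S.1 : LocalConfig E3).toMeasure with hμ
  have hρ01 : ∀ s, 0 ≤ ρ[R, s] ∧ ρ[R, s] ≤ 1 := fun s =>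
    ⟨le_max_left _ _, max_le zero_le_one ((min_le_left _ _).trans (min_le_left _ _))⟩
  have hf : Integrable (fun y : E3 => lennardJones ‖y‖) μ := integrable_lennardJones_toMeasure hδ S
  have hg : Integrable (fun y : E3 => ρ[R, ‖y‖] * lennardJones ‖y‖) μ := by
    refine hf.norm.mono' ((continuous_cutoff_mul hδ R).1.aestronglyMeasurable)
      (Eventually.of_forall fun y => ?_)
    rw [Real.norm_eq_abs, Real.norm_eq_abs, abs_mul, abs_of_nonneg (hρ01 _).1]
    exact mul_le_of_le_one_left (abs_nonneg _) (hρ01 _).2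
  rw [← integral_sub hf hg]
  -- the pointwise tail domination on `S`
  set h : E3 → ℝ := fun y => lennardJones ‖y‖ - ρ[R, ‖y‖] * lennardJones ‖y‖ with hh
  have hbound : ∀ T : Finset E3, (↑T : Set E3) ⊆ ((S.1 : LocalConfig E3) : Set E3) →
      ∑ y ∈ T, |h y| ≤ (125 / 2) * δ⁻¹ ^ 5 * R⁻¹ := by
    intro T hT
    have hsplit : ∑ y ∈ T, |h y| = ∑ y ∈ T.filter (fun y => R < ‖y‖), |h y| := by
      rw [Finset.sum_filter]
      refine Finset.sum_congr rfl fun y hy => ?_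
      split_ifs with hyR
      · rfl
      · rw [not_lt] at hyR
        rw [hh]
        dsimp only
        by_cases hy0 : y = 0
        · simp [hy0, lennardJones_zero]
        · have hδy : δ ≤ ‖y‖ := norm_ge_of_mem S (hT hy) hy0
          have h1 : 1 ≤ (‖y‖ - δ / 2) * (2 / δ) := by
            rw [mul_div_assoc', le_div_iff₀ hδ]; linarith
          have hρ1 : ρ[R, ‖y‖] = 1 := by
            rw [min_eq_left h1, min_eq_left (by linarith : (1 : ℝ) ≤ R + 1 - ‖y‖),
              max_eq_right zero_le_one]
          rw [hρ1, one_mul, sub_self, abs_zero]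
    rw [hsplit]
    calc ∑ y ∈ T.filter (fun y => R < ‖y‖), |h y|
        ≤ ∑ y ∈ T.filter (fun y => R < ‖y‖), |lennardJones ‖y‖| := by
          refine Finset.sum_le_sum fun y _ => ?_
          rw [hh]
          dsimp only
          rw [show lennardJones ‖y‖ - ρ[R, ‖y‖] * lennardJones ‖y‖ =
            (1 - ρ[R, ‖y‖]) * lennardJones ‖y‖ by ring, abs_mul,
            abs_of_nonneg (by linarith [(hρ01 ‖y‖).2])]
          exact mul_le_of_le_one_left (abs_nonneg _) (by linarith [(hρ01 ‖y‖).1])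
      _ ≤ (125 / 2) * δ⁻¹ ^ 5 * R⁻¹ :=
          sum_abs_lennardJones_tail_le hδ S _
            ((Finset.coe_subset.2 (Finset.filter_subset _ T)).trans hT) hR
            fun y hy => (Finset.mem_filter.1 hy).2
  -- integrate
  have hhi : Integrable h μ := hf.sub hg
  calc |∫ y, h y ∂μ| ≤ ∫ y, |h y| ∂μ := by
        have := norm_integral_le_integral_norm (μ := μ) h
        simpa only [Real.norm_eq_abs] using this
    _ = (∫⁻ y, ENNReal.ofReal |h y| ∂μ).toReal :=
        integral_eq_lintegral_of_nonneg_ae (Eventually.of_forall fun y => abs_nonneg _)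
          hhi.norm.aestronglyMeasurable
    _ ≤ (125 / 2) * δ⁻¹ ^ 5 * R⁻¹ := by
        refine ENNReal.toReal_le_of_le_ofReal (by positivity) ?_
        refine lintegral_toMeasure_le_of_forall_finset hδ S fun T hT => ?_
        rw [← ENNReal.ofReal_sum_of_nonneg fun y _ => abs_nonneg _]
        exact ENNReal.ofReal_le_ofReal (hbound T hT)

/-- **The root energy is a continuous local functional** on the compact metric space of rooted
`δ`-hard-core configurations of `ℝ³` (`δ > 0`): it is the uniform limit of the continuous local
functionals `S ↦ ∑_{y ∈ S} ρ_R(‖y‖) V_LJ(‖y‖)` (`LocalConfig.continuous_integral_toMeasure`,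
`abs_integral_lennardJones_sub_cutoff_le`). Hence mean root energies pass to weak limits of
laws. [folklore] -/
theorem continuous_integral_lennardJones_toMeasure (hδ : 0 < δ) :
    Continuous fun S : RootedHardCoreConfig E3 δ =>
      ∫ y, lennardJones ‖y‖ ∂((S.1 : LocalConfig E3).toMeasure) := by
  refine continuous_of_uniform_approx_of_continuous fun u hu => ?_
  obtain ⟨ε, hε, hεu⟩ := Metric.mem_uniformity_dist.1 hu
  -- `R ≥ 1` with tail `< ε`
  set R : ℝ := max 1 ((125 / 2) * δ⁻¹ ^ 5 * (2 / ε)) with hR_def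
  have hR1 : 1 ≤ R := le_max_left _ _
  have hR0 : 0 < R := by linarith
  have htail : (125 / 2) * δ⁻¹ ^ 5 * R⁻¹ < ε := by
    have h1 : (125 / 2) * δ⁻¹ ^ 5 * (2 / ε) ≤ R := le_max_right _ _
    rw [mul_comm, ← div_eq_inv_mul, div_lt_iff₀ hR0]
    have h2 : (125 / 2) * δ⁻¹ ^ 5 * (2 / ε) * ε = 2 * ((125 / 2) * δ⁻¹ ^ 5) := by
      field_simp
    nlinarith [h1, mul_le_mul_of_nonneg_right h1 hε.le,
      (by positivity : (0 : ℝ) ≤ (125 / 2) * δ⁻¹ ^ 5)]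
  refine ⟨fun S : RootedHardCoreConfig E3 δ =>
    ∫ y, ρ[R, ‖y‖] * lennardJones ‖y‖ ∂((S.1 : LocalConfig E3).toMeasure),
    continuous_integral_toMeasure hδ (continuous_cutoff_mul hδ R).1 (continuous_cutoff_mul hδ R).2,
    fun S => hεu ?_⟩
  rw [Real.dist_eq]
  exact (abs_integral_lennardJones_sub_cutoff_le hδ S hR1).trans_lt htail

end Summit.AtomisticToContinuum.Crystallization.Theorems.BenjaminiSchrammLimit
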